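import Mathlib.MeasureTheory.Function.UnifTight
import Mathlib.MeasureTheory.Function.UniformIntegrable
import HarnessLib

/-!
# Equi-integrability and uniform tightness in `L¹` by domination

Topic: Analysis / FunctionSpaces (general measure theory; the bookkeeping half of the
Dunford–Pettis criterion as used in kinetic theory, CIP 1994 §5.3 Steps 8–9). Everything is
proved; the file declares theorems only.

* `eLpNorm_one_indicator_eq_setLIntegral`: `‖1_s f‖_{L¹} = ∫⁻_s ‖f‖ₑ`.
* `unifIntegrable_of_dominated_split`: if `(g i)` is equi-integrable
  (`MeasureTheory.UnifIntegrable _ 1 μ`) and, for every `ε > 0`, `‖f i‖ₑ ≤ K ‖g i‖ₑ + M + dᵢ`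
  a.e. with constants `K, M` and `∫ dᵢ ≤ ε`, then `(f i)` is equi-integrable.
* `unifTight_of_dominated_split`: the analogue for uniform tightness
  (`MeasureTheory.UnifTight _ 1 μ`), with the domination required off a set of finite measure.
* `eLpNorm_one_le_of_dominated`: the corresponding uniform `L¹` bound.

These are the forms in which the weak compactness of the collision terms of the DiPerna–Lions
approximating sequence (CIP 1994 Lemma 5.3.7) is reduced to estimates: the loss term is dominated
by a bounded part plus parts of small integral, the gain term by `K ×` the loss term plus
`(log K)⁻¹ ×` the entropy dissipation.

## References

* C. Cercignani, R. Illner, M. Pulvirenti, *The Mathematical Theory of Dilute Gases*, Springer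
  (1994), §5.3 Step 8 (the Dunford–Pettis criterion (ii a,b,c)), pp. 147–148.
* I. Fonseca, G. Leoni, *Modern Methods in the Calculus of Variations: `L^p` Spaces* (2007),
  §2.1.3 (equi-integrability).
-/

noncomputable section

open MeasureTheory Filter Topology Set
open scoped ENNReal NNReal

namespace Literature.Analysis.FunctionSpaces

variable {α ι : Type*} [MeasurableSpace α] {μ : Measure α}

/-- The `L¹` "norm" of the restriction to a measurable set is the set integral of `‖f‖ₑ`.
[folklore] -/
theorem eLpNorm_one_indicator_eq_setLIntegral {β : Type*} [NormedAddCommGroup β] (f : α → β)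
    {s : Set α} (hs : MeasurableSet s) :
    eLpNorm (s.indicator f) 1 μ = ∫⁻ x in s, ‖f x‖ₑ ∂μ := by
  rw [eLpNorm_one_eq_lintegral_enorm, ← lintegral_indicator hs]
  refine lintegral_congr fun x => ?_
  rw [enorm_indicator_eq_indicator_enorm]

/-- `(K : ℝ≥0∞) · ofReal a = ofReal (K a)` for `K : ℝ≥0`. [folklore] -/
theorem coe_nnreal_mul_ofReal (K : ℝ≥0) (a : ℝ) :
    (K : ℝ≥0∞) * ENNReal.ofReal a = ENNReal.ofReal (K * a) := by
  rw [← ENNReal.ofReal_coe_nnreal, ← ENNReal.ofReal_mul (NNReal.coe_nonneg K)]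

/-- **Equi-integrability by dominated splitting.** Let `(g i)` be equi-integrable in `L¹`. If for
every `ε > 0` there are constants `K, M ≥ 0` such that each `f i` is dominated as
`‖f i‖ₑ ≤ K ‖g i‖ₑ + M + dᵢ` a.e. with `dᵢ` a.e.-measurable and `∫ dᵢ ≤ ε`, then `(f i)` is
equi-integrable in `L¹` (the constant `M` is absorbed by the smallness of the set, `dᵢ` by its
small integral, `K ‖g i‖ₑ` by the equi-integrability of `g`). [folklore] -/
theorem unifIntegrable_of_dominated_split {β γ : Type*} [NormedAddCommGroup β] [NormedAddCommGroup γ]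
    {f : ι → α → β} {g : ι → α → γ} (hg : UnifIntegrable g 1 μ)
    (h : ∀ ε : ℝ, 0 < ε → ∃ K M : ℝ≥0, ∀ i, ∃ d : α → ℝ≥0∞, AEMeasurable d μ ∧
      ∫⁻ x, d x ∂μ ≤ ENNReal.ofReal ε ∧ ∀ᵐ x ∂μ, ‖f i x‖ₑ ≤ K * ‖g i x‖ₑ + M + d x) :
    UnifIntegrable f 1 μ := by
  intro ε hε
  have hε3 : 0 < ε / 3 := by positivity
  obtain ⟨K, M, hKM⟩ := h (ε / 3) hε3
  have hK1 : (0 : ℝ) < K + 1 := by positivity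
  have hM1 : (0 : ℝ) < M + 1 := by positivity
  obtain ⟨δ₁, hδ₁, hg'⟩ := hg (show 0 < ε / 3 / (K + 1) by positivity)
  set δ : ℝ := min δ₁ (ε / 3 / (M + 1)) with hδ
  have hδpos : 0 < δ := lt_min hδ₁ (by positivity)
  refine ⟨δ, hδpos, fun i s hs hμs => ?_⟩
  obtain ⟨d, hdm, hd, hdom⟩ := hKM i
  have hμs₁ : μ s ≤ ENNReal.ofReal δ₁ := hμs.trans (ENNReal.ofReal_le_ofReal (min_le_left _ _))
  have hgs := hg' i s hs hμs₁
  rw [eLpNorm_one_indicator_eq_setLIntegral _ hs] at hgs ⊢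
  -- integrate the domination over `s`
  have h1 : ∫⁻ x in s, ‖f i x‖ₑ ∂μ ≤ ∫⁻ x in s, ((K : ℝ≥0∞) * ‖g i x‖ₑ + M + d x) ∂μ :=
    lintegral_mono_ae (ae_restrict_of_ae hdom)
  have h2 : ∫⁻ x in s, ((K : ℝ≥0∞) * ‖g i x‖ₑ + M + d x) ∂μ =
      (K : ℝ≥0∞) * ∫⁻ x in s, ‖g i x‖ₑ ∂μ + (M : ℝ≥0∞) * μ s + ∫⁻ x in s, d x ∂μ := by
    rw [lintegral_add_right' _ hdm.restrict, lintegral_add_right' _ aemeasurable_const,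
      lintegral_const_mul' _ _ ENNReal.coe_ne_top, setLIntegral_const]
  -- the three bounds
  have b1 : (K : ℝ≥0∞) * ∫⁻ x in s, ‖g i x‖ₑ ∂μ ≤ ENNReal.ofReal (ε / 3) := by
    calc (K : ℝ≥0∞) * ∫⁻ x in s, ‖g i x‖ₑ ∂μ ≤ (K : ℝ≥0∞) * ENNReal.ofReal (ε / 3 / (K + 1)) :=
          mul_le_mul_of_nonneg_left hgs bot_le
      _ = ENNReal.ofReal (K * (ε / 3 / (K + 1))) := coe_nnreal_mul_ofReal _ _
      _ ≤ ENNReal.ofReal (ε / 3) := by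
          refine ENNReal.ofReal_le_ofReal ?_
          rw [mul_div_assoc', div_le_iff₀ hK1]
          nlinarith [NNReal.coe_nonneg K]
  have b2 : (M : ℝ≥0∞) * μ s ≤ ENNReal.ofReal (ε / 3) := by
    calc (M : ℝ≥0∞) * μ s ≤ (M : ℝ≥0∞) * ENNReal.ofReal δ := mul_le_mul_of_nonneg_left hμs bot_le
      _ = ENNReal.ofReal (M * δ) := coe_nnreal_mul_ofReal _ _
      _ ≤ ENNReal.ofReal (ε / 3) := by
          refine ENNReal.ofReal_le_ofReal ?_
          have : δ ≤ ε / 3 / (M + 1) := min_le_right _ _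
          calc (M : ℝ) * δ ≤ M * (ε / 3 / (M + 1)) := mul_le_mul_of_nonneg_left this (NNReal.coe_nonneg M)
            _ ≤ ε / 3 := by
                rw [mul_div_assoc', div_le_iff₀ hM1]; nlinarith [NNReal.coe_nonneg M]
  have b3 : ∫⁻ x in s, d x ∂μ ≤ ENNReal.ofReal (ε / 3) := (setLIntegral_le_lintegral s _).trans hd
  calc ∫⁻ x in s, ‖f i x‖ₑ ∂μ ≤ _ := h1
    _ = _ := h2
    _ ≤ ENNReal.ofReal (ε / 3) + ENNReal.ofReal (ε / 3) + ENNReal.ofReal (ε / 3) :=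
        add_le_add (add_le_add b1 b2) b3
    _ = ENNReal.ofReal ε := by
        rw [← ENNReal.ofReal_add hε3.le hε3.le, ← ENNReal.ofReal_add (by positivity) hε3.le]
        congr 1; ring

/-- **Uniform tightness by dominated splitting.** Let `(g i)` be uniformly tight in `L¹`. If for
every `ε > 0` there are `K ≥ 0` and a set `s₀` of finite measure such that each `f i` is
dominated off `s₀` as `‖f i‖ₑ ≤ K ‖g i‖ₑ + dᵢ` a.e. with `∫ dᵢ ≤ ε`, then `(f i)` is uniformly
tight in `L¹`. [folklore] -/
theorem unifTight_of_dominated_split {β γ : Type*} [NormedAddCommGroup β] [NormedAddCommGroup γ]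
    {f : ι → α → β} {g : ι → α → γ} (hg : UnifTight g 1 μ)
    (h : ∀ ε : ℝ, 0 < ε → ∃ K : ℝ≥0, ∃ s₀ : Set α, MeasurableSet s₀ ∧ μ s₀ ≠ ∞ ∧ ∀ i,
      ∃ d : α → ℝ≥0∞, AEMeasurable d μ ∧ ∫⁻ x, d x ∂μ ≤ ENNReal.ofReal ε ∧
        ∀ᵐ x ∂μ, x ∉ s₀ → ‖f i x‖ₑ ≤ K * ‖g i x‖ₑ + d x) :
    UnifTight f 1 μ := by
  rw [unifTight_iff_real]
  intro ε hε
  have hε2 : 0 < ε / 2 := by positivity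
  obtain ⟨K, s₀, hs₀m, hs₀, hK⟩ := h (ε / 2) hε2
  have hK1 : (0 : ℝ) < K + 1 := by positivity
  obtain ⟨s₁, hs₁, hg'⟩ := (unifTight_iff_real _ _ _).1 hg (show 0 < ε / 2 / (K + 1) by positivity)
  -- we may take `s₁` measurable
  set s₁' : Set α := toMeasurable μ s₁ with hs₁'
  have hs₁'m : MeasurableSet s₁' := measurableSet_toMeasurable _ _
  have hs₁'fin : μ s₁' ≠ ∞ := by rwa [hs₁', measure_toMeasurable]
  refine ⟨s₀ ∪ s₁', measure_union_ne_top hs₀ hs₁'fin, fun i => ?_⟩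
  obtain ⟨d, hdm, hd, hdom⟩ := hK i
  have hg₁ : eLpNorm (s₁'ᶜ.indicator (g i)) 1 μ ≤ ENNReal.ofReal (ε / 2 / (K + 1)) := by
    refine le_trans (eLpNorm_mono fun x => ?_) (hg' i)
    rw [norm_indicator_eq_indicator_norm, norm_indicator_eq_indicator_norm]
    refine indicator_le_indicator_of_subset (compl_subset_compl.2 (subset_toMeasurable _ _))
      (fun _ => norm_nonneg _) x
  rw [eLpNorm_one_eq_lintegral_enorm] at hg₁ ⊢
  have hpt : ∀ᵐ x ∂μ, ‖(s₀ ∪ s₁')ᶜ.indicator (f i) x‖ₑ ≤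
      (K : ℝ≥0∞) * ‖s₁'ᶜ.indicator (g i) x‖ₑ + d x := by
    filter_upwards [hdom] with x hx
    by_cases hxs : x ∈ (s₀ ∪ s₁')ᶜ
    · rw [mem_compl_iff, mem_union, not_or] at hxs
      rw [enorm_indicator_eq_indicator_enorm, indicator_of_mem (by simpa [mem_union] using hxs),
        enorm_indicator_eq_indicator_enorm, indicator_of_mem (show x ∈ s₁'ᶜ from hxs.2)]
      exact hx hxs.1
    · rw [enorm_indicator_eq_indicator_enorm, indicator_of_notMem hxs]
      exact bot_le
  calc ∫⁻ x, ‖(s₀ ∪ s₁')ᶜ.indicator (f i) x‖ₑ ∂μ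
      ≤ ∫⁻ x, ((K : ℝ≥0∞) * ‖s₁'ᶜ.indicator (g i) x‖ₑ + d x) ∂μ := lintegral_mono_ae hpt
    _ = (K : ℝ≥0∞) * ∫⁻ x, ‖s₁'ᶜ.indicator (g i) x‖ₑ ∂μ + ∫⁻ x, d x ∂μ := by
        rw [lintegral_add_right' _ hdm, lintegral_const_mul' _ _ ENNReal.coe_ne_top]
    _ ≤ ENNReal.ofReal (ε / 2) + ENNReal.ofReal (ε / 2) := by
        refine add_le_add ?_ hd
        calc (K : ℝ≥0∞) * ∫⁻ x, ‖s₁'ᶜ.indicator (g i) x‖ₑ ∂μ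
            ≤ (K : ℝ≥0∞) * ENNReal.ofReal (ε / 2 / (K + 1)) := mul_le_mul_of_nonneg_left hg₁ bot_le
          _ = ENNReal.ofReal (K * (ε / 2 / (K + 1))) := coe_nnreal_mul_ofReal _ _
          _ ≤ ENNReal.ofReal (ε / 2) := by
              refine ENNReal.ofReal_le_ofReal ?_
              rw [mul_div_assoc', div_le_iff₀ hK1]
              nlinarith [NNReal.coe_nonneg K]
    _ = ENNReal.ofReal ε := by rw [← ENNReal.ofReal_add hε2.le hε2.le, add_halves]

/-- **Uniform `L¹` bound by domination**: if `‖f i‖ₑ ≤ K ‖g i‖ₑ + dᵢ` a.e. with `∫ dᵢ ≤ D` and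
`‖g i‖₁ ≤ C`, then `‖f i‖₁ ≤ K C + D`. [folklore] -/
theorem eLpNorm_one_le_of_dominated {β γ : Type*} [NormedAddCommGroup β] [NormedAddCommGroup γ]
    {f : α → β} {g : α → γ} {K C D : ℝ≥0∞} {d : α → ℝ≥0∞} (hK : K ≠ ∞) (hdm : AEMeasurable d μ)
    (hdom : ∀ᵐ x ∂μ, ‖f x‖ₑ ≤ K * ‖g x‖ₑ + d x) (hg : eLpNorm g 1 μ ≤ C)
    (hd : ∫⁻ x, d x ∂μ ≤ D) : eLpNorm f 1 μ ≤ K * C + D := by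
  rw [eLpNorm_one_eq_lintegral_enorm] at hg ⊢
  calc ∫⁻ x, ‖f x‖ₑ ∂μ ≤ ∫⁻ x, (K * ‖g x‖ₑ + d x) ∂μ := lintegral_mono_ae hdom
    _ = K * ∫⁻ x, ‖g x‖ₑ ∂μ + ∫⁻ x, d x ∂μ := by
        rw [lintegral_add_right' _ hdm, lintegral_const_mul' _ _ hK]
    _ ≤ K * C + D := add_le_add (mul_le_mul_of_nonneg_left hg bot_le) hd

end Literature.Analysis.FunctionSpaces
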